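import Summits.BirchSwinnertonDyer.BirchSwinnertonDyer.Theorems.EisensteinPrimesGrSelmerImprimitiveLambdaShift
import HarnessLib

/-!
# The imprimitive STRICT (`𝓕_Gr`) Selmer dual `𝔛^{S₂}_Gr` of a GENERIC `p`-primary module is finitely
# generated, `Λ`-torsion, `μ(𝔛^{S₂}_Gr) = μ(𝔛^{S₁}_Gr)` and `λ(𝔛^{S₂}_Gr) = λ(𝔛^{S₁}_Gr) + corank` as soon
# as `𝔛^{S₁}_Gr` is f.g. torsion and the `p`-torsion of `H¹_{𝓕_Gr^{S₂}}/H¹_{𝓕_Gr^{S₁}}` is FINITE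

Cell `bsd-eis` (home `run/shared/lean/pub/bsd-eis/`), width seat `bsd-line-x2-p2` g27, crux 4
`BSDpOnCellC` (stmt-BirchSwinnertonDyer-19034), line `telescope` v21 (skeleton of record 9eb63b9f…,
UNCHANGED; helper `--supports`, no stub closed). The STRICT twin of seat k5-c2 g11's
`Theorems/EisensteinPrimesUnrSelmerImprimitiveFiniteness.lean` (p569470; the same algebra for
Keller–Yin's UNRAMIFIED groups `unrSelmer` / `GreenbergVatsal2000.DatumDualData`): here for the
Greenberg/STRICT groups `KellerYin2024.grSelmer κ M vbar S = H¹_{𝓕_Gr^S}(K_∞, M)` and their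
Pontryagin-dual data `KellerYin2024.GrDualData κ M vbar S γ` — the currency of Castella–Grossi–Lee–
Skinner 2022 §1.2 (`𝔛_θ^S = H¹_{F_Gr}^S(K, M_θ)^∨`), in which CGLS Prop. 1.2.5
(`prop125_characterGrSelmerDual_torsion_muZero_dim`, conjunct #16 of the line's `stub_publishedFacts`)
is stated. WHY: the sibling `GrSelmerImprimitiveLambdaShift` (x2-p2 g8, p-landed) passes f.g./torsion/`μ = 0`
DOWN from `𝔛^{S₂}` to `𝔛^{S₁}`; Prop. 1.2.5's printed proof goes UP — "Thm. 1.2.2 (Rubin, Hida) for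
`𝔛_θ` … (eq:sur2) … therefore `𝔛_θ^S` is `Λ`-torsion with `μ = 0`" — and the UP direction is what
a derivation of Prop. 1.2.5's module clause from the two-variable main conjecture (BCGKPST Thm. 3.3.1,
de Shalit II.6.4, Hida Thm. I — already on the line's list) has to use. This file is that UP step for a
generic module, with the local input isolated as the hypothesis `Finite (Q[p])` (supplied for the
character modules at split `S` by the sibling `EisensteinPrimesGrSelmerQuotientTorsionFinite`).

HONEST FRAMING: tool theorems only (no definition, no named fact, no `sorry`), generic discrete
`p`-primary `Γ_K`-module `M` with open stabilisers, any number field, any `ℤ_p`-extension, any place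
`vbar`, any `S₁ ⊆ S₂`; ported line by line from the `𝓕_nr` file (`unrSelmer ↦ grSelmer`,
`conjUnr ↦ conjGr`, `DatumDualData ↦ GrDualData`, `UnrSelmerImprimitiveLambdaShift.{exists_restrictDual,
nonempty_ker_addEquiv_characterModule, isPrimary_quotient} ↦ GrSelmerImprimitiveLambdaShift.…`).
Nothing here closes a stub of telescope v21; no Literature fact is discharged by this file alone; BSD
is proved for no curve; no label or count moves.

## What (notation: `Sel^{Sᵢ} = grSelmer κ M vbar Sᵢ`, `X` / `X₀` strict dual data of `Sel^{S₁}` / `Sel^{S₂}`)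
* §1 `isDualPair_grDualData` — any strict dual datum is an `IwasawaDual.IsDualPair` for `ψ = conj_γ − 1`.
* §2 `exists_finset_cover_of_finite_torsionBy` — `Q[p]` finite ⇒ a finite-coset cover of
  `{s ∈ Sel^{S₂} | p s ∈ Sel^{S₁}}`; `finite_piece_one_imprimitive` — `Sel^{S₁}[𝔪]` finite ⇒
  `Sel^{S₂}[𝔪]` finite (slices of the cover are translates of `Sel^{S₁}[𝔪]`).
* §3 **`moduleFinite_isTorsion_mu_lambda_of_primitive`**: `X` f.g. torsion and `Q[p]` finite ⇒ `X₀`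
  f.g. (Nakayama on the dual pair), torsion (`(ker r)/p` finite for the dual restriction `r : X₀ ↠ X`,
  `ker r ≅ Hom(Q, ℚ/ℤ)`), `μ(X₀) = μ(X)`, and `λ(X₀) = λ(X) + corank_{ℤ_p}(Q)`;
  `moduleFinite_isTorsion_muZero_of_primitive` — the `μ = 0` corollary in the shape CGLS Prop. 1.2.5's
  consumers use (`Module.Finite ∧ IsTorsion ∧ μ = 0` for EVERY strict dual datum at `S₂`).

References: Greenberg–Vatsal 2000 §2 Cor. (2.3), pp. 20–21; Greenberg LNM 1716 §1 p. 60; CGLS 2022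
Prop. 1.2.5 and proof (arXiv:2008.02571 Prop. 14); KY 2024 Prop. 1.2.5 (TeX L780–800).
-/

set_option linter.dupNamespace false
set_option autoImplicit false

noncomputable section

open scoped Classical AddSubgroup

open NumberField IsDedekindDomain Field
open Summit.BirchSwinnertonDyer.Rank1Residual
open Literature.NumberTheory.EllipticCurves Literature.NumberTheory.EllipticCurves.GreenbergSelmer
  Literature.NumberTheory.EllipticCurves.GreenbergVatsal2000
  Literature.NumberTheory.EllipticCurves.IwasawaDual
  Literature.NumberTheory.EllipticCurves.KellerYin2024
  Literature.NumberTheory.GaloisRepresentations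
open Summit.BirchSwinnertonDyer.BirchSwinnertonDyer.Theorems.GrSelmerImprimitiveLambdaShift

universe u

namespace Summit.BirchSwinnertonDyer.BirchSwinnertonDyer.Theorems.GrSelmerImprimitiveFiniteness

variable {K : Type u} [Field K] [NumberField K] {p : ℕ} [Fact p.Prime] (κ : ZpExtension K p)
  {M : Type u} [AddCommGroup M] [DistribMulAction (absoluteGaloisGroup K) M] [TopologicalSpace M]
  [DiscreteTopology M] (vbar : HeightOneSpectrum (𝓞 K))

/-! ## §1. A strict dual datum of `H¹_{𝓕_Gr^S}(K_∞, M)` is a dual pair -/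

/-- Every `KellerYin2024.GrDualData` of `H¹_{𝓕_Gr^{S₀}}(K_∞, M)` is an axiomatic Pontryagin dual pair for
`ψ = conj_γ − 1` (`conjGr`): `toDual_T_smul`, `toDual_C_smul`, and local nilpotence
`isLocNil_conjGr_sub_one` for `γ` a topological generator (strict twin of
`UnrSelmerImprimitiveFiniteness.isDualPair_datumDualData`, itself a port of b2b
`Iwasawa.isDualPair_datumDualData`). [cite: GreenbergLNM1716, §1 (after Conj. 1.3)] -/
theorem isDualPair_grDualData (htor : ∀ m : M, ∃ k : ℕ, p ^ k • m = 0)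
    (hstab : ∀ m : M, IsOpen (MulAction.stabilizer (absoluteGaloisGroup K) m : Set (absoluteGaloisGroup K)))
    {γ : absoluteGaloisGroup K} (hγ : κ.IsTopGenerator γ) (S₀ : Set (HeightOneSpectrum (𝓞 K)))
    (D : GrDualData κ M vbar S₀ γ) :
    IsDualPair p (conjGr κ M vbar S₀ γ - 1) D.toDual where
  bijective := D.bijective
  T_smul x s := by
    rw [D.toDual_T_smul, IwasawaDual.End_sub_apply, AddMonoid.End.one_apply, map_sub]
  C_smul c x s k hk := D.toDual_C_smul c x s k hk
  locNil := isLocNil_conjGr_sub_one κ vbar S₀ htor hstab hγ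

/-! ## §2. `Q[p]` finite ⇒ a finite-coset cover; `Sel^{S₁}[𝔪]` finite ⇒ `Sel^{S₂}[𝔪]` finite -/

/-- **A finite-coset cover from `Q[p]` finite**: if the `p`-torsion of
`Q = Sel^{S₂}/Sel^{S₁}` (STRICT groups `Sel^{Sᵢ} = H¹_{𝓕_Gr^{Sᵢ}}(K_∞, M)`) is finite, some finite
`F ⊆ Sel^{S₂}` meets every class `s + Sel^{S₁}` with `p s ∈ Sel^{S₁}` (representatives of `Q[p]`).
[cite: GreenbergVatsal2000, §2 pp. 20–21] -/
theorem exists_finset_cover_of_finite_torsionBy {S₁ S₂ : Set (HeightOneSpectrum (𝓞 K))}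
    (hQ : Finite ((↥(grSelmer κ M vbar S₂) ⧸
      (grSelmer κ M vbar S₁).addSubgroupOf (grSelmer κ M vbar S₂))[(p : ℤ)])) :
    ∃ F : Finset ↥(grSelmer κ M vbar S₂), ∀ s : ↥(grSelmer κ M vbar S₂),
      p • (s : subgroupH1 κ.kerSubgroup M) ∈ grSelmer κ M vbar S₁ →
        ∃ f ∈ F, (s : subgroupH1 κ.kerSubgroup M) - (f : subgroupH1 κ.kerSubgroup M) ∈
          grSelmer κ M vbar S₁ := by
  set SS := grSelmer κ M vbar S₂ with hSS
  set S := grSelmer κ M vbar S₁ with hS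
  set N : AddSubgroup SS := S.addSubgroupOf SS with hN
  have hNmem : ∀ s : SS, s ∈ N ↔ (s : subgroupH1 κ.kerSubgroup M) ∈ S := fun s ↦
    AddSubgroup.mem_addSubgroupOf
  -- representatives of the finitely many `p`-torsion classes
  have hrep : ∀ q : (SS ⧸ N)[(p : ℤ)], ∃ s : SS, QuotientAddGroup.mk' N s = (q : SS ⧸ N) := fun q ↦
    QuotientAddGroup.mk'_surjective N q
  choose g hg using hrep
  haveI := hQ
  haveI : Fintype ((SS ⧸ N)[(p : ℤ)]) := Fintype.ofFinite _
  refine ⟨Finset.univ.image g, fun s hps ↦ ?_⟩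
  have hcls : QuotientAddGroup.mk' N s ∈ (SS ⧸ N)[(p : ℤ)] := by
    refine AddSubgroup.torsionBy.nsmul_iff.mpr ?_
    rw [← map_nsmul, QuotientAddGroup.mk'_apply, QuotientAddGroup.eq_zero_iff, hNmem,
      AddSubgroupClass.coe_nsmul]
    exact hps
  refine ⟨g ⟨_, hcls⟩, Finset.mem_image_of_mem _ (Finset.mem_univ _), ?_⟩
  have h : QuotientAddGroup.mk' N (g ⟨_, hcls⟩) = QuotientAddGroup.mk' N s := hg ⟨_, hcls⟩
  generalize g ⟨_, hcls⟩ = f at h ⊢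
  rw [QuotientAddGroup.mk'_apply, QuotientAddGroup.mk'_apply, QuotientAddGroup.eq_iff_sub_mem, hNmem,
    AddSubgroupClass.coe_sub] at h
  -- `h : g - s ∈ S`; we want `s - g ∈ S`
  have h' := S.neg_mem h
  rwa [neg_sub] at h'

/-- Membership in `Sel^{S₀}[𝔪] = piece 1` for `ψ = conj_γ − 1`: `p s = 0` and `conj_γ s = s` (on the
underlying classes). [folklore] -/
theorem mem_piece_one_conjGr_iff (S₀ : Set (HeightOneSpectrum (𝓞 K))) (γ : absoluteGaloisGroup K)
    (s : grSelmer κ M vbar S₀) :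
    s ∈ piece p (conjGr κ M vbar S₀ γ - 1) 1 ↔
      p • (s : subgroupH1 κ.kerSubgroup M) = 0 ∧
        conjH1 κ.kerSubgroup M γ s = (s : subgroupH1 κ.kerSubgroup M) := by
  rw [mem_piece, pow_one, pow_one, IwasawaDual.End_sub_apply, AddMonoid.End.one_apply, sub_eq_zero,
    Subtype.ext_iff, Subtype.ext_iff, AddSubgroupClass.coe_nsmul, ZeroMemClass.coe_zero,
    coe_conjGr_apply κ vbar S₀ γ]

/-- **`Sel^{S₁}[𝔪]` finite and `Q[p]` finite ⇒ `Sel^{S₂}[𝔪]` finite** (`[𝔪]` = killed by `p` and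
fixed by `conj_γ`, the `IwasawaDual.piece … 1` of the tree's Nakayama lemma): an element of
`Sel^{S₂}[𝔪]` has `p s = 0 ∈ Sel^{S₁}`, so lies in one of the finitely many classes `f + Sel^{S₁}` of
the cover, and two elements of the same class differ by an element of `Sel^{S₁}[𝔪]` (strict twin of
`UnrSelmerImprimitiveFiniteness.finite_piece_one_imprimitive`; port of b2b
`Iwasawa.finite_piece_one_nonPrimitive_of_finite_piece_one`).
[cite: GreenbergVatsal2000, §2 Cor. (2.3) (arXiv:math/9906215 pp. 20–21)] -/
theorem finite_piece_one_imprimitive {S₁ S₂ : Set (HeightOneSpectrum (𝓞 K))} (h12 : S₁ ⊆ S₂)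
    (γ : absoluteGaloisGroup K)
    (hQ : Finite ((↥(grSelmer κ M vbar S₂) ⧸
      (grSelmer κ M vbar S₁).addSubgroupOf (grSelmer κ M vbar S₂))[(p : ℤ)]))
    (hfin : (piece p (conjGr κ M vbar S₁ γ - 1) 1 : Set (grSelmer κ M vbar S₁)).Finite) :
    (piece p (conjGr κ M vbar S₂ γ - 1) 1 : Set (grSelmer κ M vbar S₂)).Finite := by
  set SS := grSelmer κ M vbar S₂ with hSS
  set S := grSelmer κ M vbar S₁ with hS
  have hle : S ≤ SS := grSelmer_mono κ M vbar h12
  obtain ⟨F, hF⟩ := exists_finset_cover_of_finite_torsionBy κ vbar hQ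
  -- the slices `A_f = {s ∈ Sel^{S₂}[𝔪] | s - f ∈ Sel^{S₁}}`
  have hcover : (piece p (conjGr κ M vbar S₂ γ - 1) 1 : Set SS) ⊆
      ⋃ f ∈ F, {s : SS | s ∈ piece p (conjGr κ M vbar S₂ γ - 1) 1 ∧
        (s : subgroupH1 κ.kerSubgroup M) - f ∈ S} := by
    intro s hs
    have hps : p • (s : subgroupH1 κ.kerSubgroup M) ∈ S := by
      rw [((mem_piece_one_conjGr_iff κ vbar S₂ γ s).1 hs).1]; exact S.zero_mem
    obtain ⟨f, hfF, hf⟩ := hF s hps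
    exact Set.mem_biUnion hfF ⟨hs, hf⟩
  refine (Set.Finite.biUnion F.finite_toSet fun f _ ↦ ?_).subset hcover
  by_cases hne : {s : SS | s ∈ piece p (conjGr κ M vbar S₂ γ - 1) 1 ∧
      (s : subgroupH1 κ.kerSubgroup M) - f ∈ S}.Nonempty
  · obtain ⟨s₀, hs₀, hs₀f⟩ := hne
    refine (hfin.image fun t ↦ s₀ + AddSubgroup.inclusion hle t).subset ?_
    rintro s ⟨hs, hsf⟩
    obtain ⟨hps, hcs⟩ := (mem_piece_one_conjGr_iff κ vbar S₂ γ s).1 hs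
    obtain ⟨hps₀, hcs₀⟩ := (mem_piece_one_conjGr_iff κ vbar S₂ γ s₀).1 hs₀
    have hmem : (s : subgroupH1 κ.kerSubgroup M) - s₀ ∈ S := by
      have e : (s : subgroupH1 κ.kerSubgroup M) - s₀ =
          ((s : subgroupH1 κ.kerSubgroup M) - f) - ((s₀ : subgroupH1 κ.kerSubgroup M) - f) := by
        abel
      rw [e]; exact S.sub_mem hsf hs₀f
    refine ⟨⟨_, hmem⟩, ?_, ?_⟩
    · rw [SetLike.mem_coe, mem_piece_one_conjGr_iff]
      refine ⟨?_, ?_⟩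
      · change p • ((s : subgroupH1 κ.kerSubgroup M) - s₀) = 0
        rw [smul_sub, hps, hps₀, sub_zero]
      · change conjH1 κ.kerSubgroup M γ ((s : subgroupH1 κ.kerSubgroup M) - s₀) = _
        rw [map_sub, hcs, hcs₀]
    · apply Subtype.ext
      change (s₀ : subgroupH1 κ.kerSubgroup M) + ((s : subgroupH1 κ.kerSubgroup M) - s₀) = s
      abel
  · rw [Set.not_nonempty_iff_eq_empty.1 hne]
    exact Set.finite_empty

/-! ## §3. `X` f.g. torsion and `Q[p]` finite ⇒ `X₀` f.g. torsion, `μ(X₀) = μ(X)`, `λ(X₀) = λ(X) + corank(Q)` -/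

/-- **Greenberg–Vatsal 2000 Cor. (2.3) for a GENERIC module and the STRICT (`𝓕_Gr`) groups, from the
finiteness of `Q[p]`.** For `M` `p`-primary with open stabilisers, `γ` a topological generator,
`S₁ ⊆ S₂`, a strict dual datum `X` of `H¹_{𝓕_Gr^{S₁}}(K_∞, M)` (`KellerYin2024.GrDualData`) that is
finitely generated and `Λ`-torsion, any strict dual datum `X₀` of `H¹_{𝓕_Gr^{S₂}}(K_∞, M)`, and
`Q = H¹_{𝓕_Gr^{S₂}}/H¹_{𝓕_Gr^{S₁}}` with FINITE `p`-torsion: `X₀` is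
finitely generated (converse Nakayama on `X` ⇒ `Sel^{S₁}[𝔪]` finite ⇒ `Sel^{S₂}[𝔪]` finite ⇒
Nakayama), `Λ`-torsion (the dual restriction `r : X₀ ↠ X` has `ker r ≅ Hom(Q, ℚ/ℤ)` with
`(ker r)/p ≅ Hom(Q[p], ℚ/ℤ)` finite), `μ(X₀) = μ(X)` (`μ(ker r) = 0`) and
`λ(X₀) = λ(X) + corank_{ℤ_p}(Q)` (`λ(ker r) = corank_{ℤ_p}(Q)`). In CGLS Prop. 1.2.5 (STRICT groups
`𝔛_θ^S = H¹_{F_Gr}^S(K, M_θ)^∨`) this is the step "(eq:sur2) … Therefore, 𝔛_θ^S is Λ-torsion with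
μ(𝔛_θ^S) = μ(𝔛_θ) = 0": with `X` f.g. torsion `μ = 0` (Thm. 1.2.2 = Rubin–Hida) and
`Q ↪ ∏_{w∈S} H¹(K_w, M_θ)` of finite `p`-torsion, `𝔛_θ^S` is f.g. torsion with `μ = 0` and
`λ(𝔛_θ^S) = λ(𝔛_θ) + corank`. The converse direction (`X₀` f.g. torsion `μ = 0` ⇒ `X`) is
`GrSelmerImprimitiveLambdaShift.lambdaInvariant_eq_add_zpCorank_of_muInvariant_eq_zero`.
[cite: GreenbergVatsal2000, §2 Cor. (2.3) and p. 21 (arXiv:math/9906215 pp. 20–21)]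
[cite: CastellaGrossiLeeSkinner2022, Prop. 1.2.5 and proof (eq:sur1)–(eq:sur2) (arXiv:2008.02571 Prop. 14; Invent. Math. 227 (2022))]
[cite: KellerYin2024, Prop. 1.2.5 (arXiv:2402.12781v2 TeX L780–800) (the 𝓕_nr twin)] -/
theorem moduleFinite_isTorsion_mu_lambda_of_primitive
    (htor : ∀ m : M, ∃ k : ℕ, p ^ k • m = 0)
    (hstab : ∀ m : M, IsOpen (MulAction.stabilizer (absoluteGaloisGroup K) m : Set (absoluteGaloisGroup K)))
    {γ : absoluteGaloisGroup K} (hγ : κ.IsTopGenerator γ) {S₁ S₂ : Set (HeightOneSpectrum (𝓞 K))}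
    (h12 : S₁ ⊆ S₂)
    (X : GrDualData κ M vbar S₁ γ)
    [Module.Finite (IwasawaAlgebra p) X.X] (hXt : Module.IsTorsion (IwasawaAlgebra p) X.X)
    (X₀ : GrDualData κ M vbar S₂ γ)
    (hQ : Finite ((↥(grSelmer κ M vbar S₂) ⧸
      (grSelmer κ M vbar S₁).addSubgroupOf (grSelmer κ M vbar S₂))[(p : ℤ)])) :
    Module.Finite (IwasawaAlgebra p) X₀.X ∧ Module.IsTorsion (IwasawaAlgebra p) X₀.X ∧
      muInvariant p X₀.X = muInvariant p X.X ∧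
      lambdaInvariant p X₀.X = lambdaInvariant p X.X +
        zpCorank (↥(grSelmer κ M vbar S₂) ⧸
          (grSelmer κ M vbar S₁).addSubgroupOf (grSelmer κ M vbar S₂)) p := by
  -- (1) finite generation: converse Nakayama on `X`, the cover, Nakayama on `X₀`
  haveI : Finite (piece p (conjGr κ M vbar S₁ γ - 1) 1) :=
    Iwasawa.finite_piece_one_of_isDualPair_of_moduleFinite
      (isDualPair_grDualData κ vbar htor hstab hγ S₁ X)
  have hfin₀ := finite_piece_one_imprimitive κ vbar h12 γ hQ (Set.toFinite _)
  haveI hfg₀ : Module.Finite (IwasawaAlgebra p) X₀.X :=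
    (isDualPair_grDualData κ vbar htor hstab hγ S₂ X₀).module_finite hfin₀
  -- (2) the dual restriction and its kernel
  obtain ⟨r, -, hsurj, hker⟩ := exists_restrictDual κ vbar htor hstab hγ h12 X X₀
  obtain ⟨Ψ⟩ := nonempty_ker_addEquiv_characterModule κ vbar h12 X₀ r hker
  haveI := hQ
  haveI : Finite (ModN (CharacterModule (↥(grSelmer κ M vbar S₂) ⧸
      (grSelmer κ M vbar S₁).addSubgroupOf (grSelmer κ M vbar S₂))) p) :=
    Iwasawa.finite_modN_characterModule_of_finite_torsionBy (p := p) _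
  haveI : Finite (ModN (LinearMap.ker r) p) :=
    Finite.of_surjective _ (modNMap_surjective (f := Ψ.symm.toAddMonoidHom) (fun y ↦ Ψ.symm.surjective y) p)
  haveI : Module.Finite (IwasawaAlgebra p) (LinearMap.ker r) := Iwasawa.moduleFinite_ker p r
  have hKt : Module.IsTorsion (IwasawaAlgebra p) (LinearMap.ker r) :=
    Iwasawa.isTorsion_of_finite_modN p (LinearMap.ker r)
  have hX₀ : Module.IsTorsion (IwasawaAlgebra p) X₀.X :=
    X2.DualRestrictionInvariants.isTorsion_of_surjective_of_ker p r hKt hXt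
  have hμK : muInvariant p (LinearMap.ker r) = 0 :=
    X2.MuVanishingOfFiniteModP.muInvariant_eq_zero_of_finite_modN p (LinearMap.ker r) hKt
  -- (3) `μ` and `λ`
  obtain ⟨-, hcork⟩ :=
    X2.NonPrimitiveSelmerCorank.finite_torsionBy_and_zpCorank_eq_lambdaInvariant p (LinearMap.ker r)
      hKt hμK (fun q ↦ isPrimary_quotient κ vbar htor (S₁ := S₁) (S₂ := S₂) q) Ψ
  refine ⟨hfg₀, hX₀, ?_, ?_⟩
  · rw [X2.DualRestrictionInvariants.muInvariant_eq_add_of_surjective p r hX₀ hsurj, hμK, zero_add]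
  · rw [X2.DualRestrictionInvariants.lambdaInvariant_eq_add_of_surjective p r hX₀ hsurj, hcork, add_comm]

/-- **CGLS Prop. 1.2.5's module clause at `S₂` FROM the module clause at `S₁ ⊆ S₂` and `Q[p]` finite**
(the shape the crux-4 consumers use): if SOME strict dual datum `X` of `H¹_{𝓕_Gr^{S₁}}(K_∞, M)` is
finitely generated `Λ`-torsion with `μ(X) = 0` and `(H¹_{𝓕_Gr^{S₂}}/H¹_{𝓕_Gr^{S₁}})[p]` is finite, then
EVERY strict dual datum `X₀` of `H¹_{𝓕_Gr^{S₂}}(K_∞, M)` is finitely generated, `Λ`-torsion, with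
`μ(X₀) = 0` (§3 with `μ(X₀) = μ(X)`). [cite: CastellaGrossiLeeSkinner2022, Prop. 1.2.5 and proof ("𝔛_θ^S is Λ-torsion with μ(𝔛_θ^S) = μ(𝔛_θ) = 0"; arXiv:2008.02571 Prop. 14)]
[cite: GreenbergVatsal2000, §2 Cor. (2.3) (arXiv:math/9906215 pp. 20–21)] -/
theorem moduleFinite_isTorsion_muZero_of_primitive
    (htor : ∀ m : M, ∃ k : ℕ, p ^ k • m = 0)
    (hstab : ∀ m : M, IsOpen (MulAction.stabilizer (absoluteGaloisGroup K) m : Set (absoluteGaloisGroup K)))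
    {γ : absoluteGaloisGroup K} (hγ : κ.IsTopGenerator γ) {S₁ S₂ : Set (HeightOneSpectrum (𝓞 K))}
    (h12 : S₁ ⊆ S₂)
    (X : GrDualData κ M vbar S₁ γ)
    [Module.Finite (IwasawaAlgebra p) X.X] (hXt : Module.IsTorsion (IwasawaAlgebra p) X.X)
    (hXμ : muInvariant p X.X = 0)
    (hQ : Finite ((↥(grSelmer κ M vbar S₂) ⧸
      (grSelmer κ M vbar S₁).addSubgroupOf (grSelmer κ M vbar S₂))[(p : ℤ)]))
    (X₀ : GrDualData κ M vbar S₂ γ) :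
    Module.Finite (IwasawaAlgebra p) X₀.X ∧ Module.IsTorsion (IwasawaAlgebra p) X₀.X ∧
      muInvariant p X₀.X = 0 := by
  obtain ⟨hfg₀, hX₀, hμ, -⟩ :=
    moduleFinite_isTorsion_mu_lambda_of_primitive κ vbar htor hstab hγ h12 X hXt X₀ hQ
  exact ⟨hfg₀, hX₀, hμ.trans hXμ⟩

end Summit.BirchSwinnertonDyer.BirchSwinnertonDyer.Theorems.GrSelmerImprimitiveFiniteness

end
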